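import Summits.HodgeConjecture.HodgeConjecture.Theorems.F0P2oLineWeilDictionaryFrameTransport -- ★ p836339 (FX) ED. 1: `transpose_pairFrame_mul_gram_mul_pairFrame`, `dictionary_frameTransport` (+ its import cone)
import Literature.NumberTheory.GelbartRogawski1991.LocalSplittingCMGaloisTransportUndoubled     -- ★ `congrW_undoubledSplittings_cmFinLocalFamily_s` (the package of record IS ★ `localSplittingCM`)
import Literature.NumberTheory.GelbartRogawski1991.LocalSplittingCMGaloisTransport               -- ★ `gram_diagonal_TW`
import Literature.NumberTheory.GelbartRogawski1991.LocalSplittingCMFrameNaturality             -- ★ (FN) (U) `frameOp_toRep_localSplittingCMWith` (B-p08 (g24))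
import HarnessLib

/-!
# Crux `H413` — N3 ROAD (a), row (FX), PART 2: the (E4) dictionary of `X_v(μ, ε, χ_f)` transports along a rational frame — PACKAGES OF RECORD, NO SIDE HYPOTHESIS

F0∕P2, cell `hodgecm-mathlib`, crux item `stmt-HodgeConjecture-24833`; A-p01 (g19) on the K1∕N3 lead B-p18 (g29)'s dealing 2026-08-31T22:14:55Z (2).  Sibling of ★ p836339
`Theorems/F0P2oLineWeilDictionaryFrameTransport.lean` ((FX) ED. 1: chart identity, pair square, generic + CM transport `dictionary_frameTransport` with hypotheses `hS`,
`hΦ₁`), split off for the 400-line rule.  PROOF lane (theorems only; no `def`, no instance, no notation, no `sorry`); `--supports stmt-HodgeConjecture-24833 --as helper`.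
HONEST LABEL: HC_CM is proved only modulo the printed citations until rung 0 closes; this file proves NO letter — it is plumbing for the (a)-side assembler of N3 #96.

WHAT IS DISCHARGED HERE (the two hypotheses of ★ `dictionary_frameTransport`, BY NAME):
* `hS` — the local Weil representations of the CM packages OF RECORD ★ `chiLocalSplittingsCM … dV′ … ε` and `… dV …` are `frameOp_{P ⊗ 1}`-intertwined along `frameConj_{P ⊗ 1}`:
  the package IS ★ `localSplittingCM` at the pair Gram `gram e₁ (realDiagonal dV) (TW ε)` (★ `congrW_undoubledSplittings_cmFinLocalFamily_s` read through the `abbrev`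
  ★ `chiLocalSplittingsCM` — `chiLocalSplittingsCM_s_eq_localSplittingCM`), and (FN) (U) ★ `frameOp_toRep_localSplittingCMWith` (B-p08 (g24), Kudla rigidity descended through the
  undoubling) at the pair frame `reindexGL e₁ (kroneckerGL (P, 1))` (frame identity ★ `transpose_pairFrame_mul_gram_mul_pairFrame`, target Gram diagonal by ★ `gram_diagonal_TW`, Borel
  σ-algebra and Mathlib's `addHaar` = the Haar data inside ★ `localSplittingCM`) — `frameOp_omegaLoc_chiLocalSplittingsCM`;
* `hΦ₁` — GR's `ω¹` at the Witt kernel lines (★ `lineWeilCM … (kernelLineCM dV′)` and `(kernelLineCM dV)`) are `frameOp`-intertwined ON THE NOSE along the rank-one rational frame `det P`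
  (`transpose_detFrame_mul_realDiagonal_kernelLineCM_mul_detFrame`: `(det P)ᵀ · (−d₀d₁d₂) · det P = −d₀′d₁′d₂′` from the determinant of `Pᵀ diag(dV) P = diag(dV′)`; the same ★ bridge at
  `N = 1` — `lineSplittingsCM_s_eq_localSplittingCM`; (U) at `n₀`; ★ `frameConj_localCenter`: the frame FIXES the `U((ε))`-member) — `frameOp_lineWeilCM`.
HEAD: **`dictionary_frameTransport_ofRecord`** — for `Pᵀ diag(dV) P = diag(dV′)` and `P·T′ = T`, every (E4)-shaped dictionary `(π, σ, Tr, η)` (F0P2-p01 (g8)'s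
`exists_dictionary_upToChar` four-clause ∃, VERBATIM tokens) for `(dV, T)` yields one for `(dV′, T′)` with the SAME `σ` and the SAME `η`.

References: [GelbartRogawski1991] §3.1 Prop. 3.1.1 p. 455, §3.2 (3.2.1)–(3.2.2) p. 457, §5.2 p. 467; [MoeglinVignerasWaldspurger1987] Chap. 2 II Remarque (3); [Kudla1994] §3 Thm. 3.1;
[PlatonovRapinchuk1994] §2.3; [Jacobowitz1962] Thm. 3.1.
-/

set_option autoImplicit false
-- the mandated namespace repeats `HodgeConjecture.HodgeConjecture`, as in every `Theorems/*.lean` of this sub-problem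
set_option linter.dupNamespace false

noncomputable section

open NumberField IsDedekindDomain Matrix MeasureTheory
open scoped MatrixGroups Kronecker
open Literature.NumberTheory.Automorphic Literature.NumberTheory.Automorphic.UnitaryGroup
open Literature.NumberTheory.GelbartRogawski1991 Literature.NumberTheory.GelbartRogawski1991.UnitaryDualPair
open Literature.NumberTheory.GelbartRogawski1991.UnitaryDualPair.LocalSplitting Literature.NumberTheory.GelbartRogawski1991.UnitaryDualPair.WeilCoinv
open Literature.NumberTheory.GelbartRogawski1991.GRConstruction
open Literature.NumberTheory.Automorphic.IdeleClassGroup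
open Literature.NumberTheory.Automorphic.Liu2021 Literature.NumberTheory.Automorphic.Liu2021.Def411WeilCarriers
open Literature.NumberTheory.Automorphic.Liu2021.Def411WeilCarriersDoubling
open Literature.RepresentationTheory Literature.RepresentationTheory.HeisenbergGroup Literature.RepresentationTheory.Liu2021
open Literature.NumberTheory.GaloisRepresentations Literature.RepresentationTheory.HarrisKudlaSweet1996
open Literature.NumberTheory.Rogawski1990

namespace Summit.HodgeConjecture.HodgeConjecture.Cruxes.H413.F0P2oLineWeilDictionaryFrameTransportOfRecord

open Summit.HodgeConjecture.HodgeConjecture.Cruxes.H413.F0P2oLineWeilDictionaryFrameTransport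

variable (L : Type) [Field L] [NumberField L] [IsCMField L] (v : HeightOneSpectrum (𝓞 ↥(maximalRealSubfield L)))
  (dV dV' : Fin 3 → L) (hdV : ∀ i, IsCMField.complexConj L (dV i) = dV i) (hdV' : ∀ i, IsCMField.complexConj L (dV' i) = dV' i)
  (P : GL (Fin 3) ↥(maximalRealSubfield L))
  (hP : (P : Matrix (Fin 3) (Fin 3) ↥(maximalRealSubfield L))ᵀ * realDiagonal L dV hdV * (P : Matrix (Fin 3) (Fin 3) ↥(maximalRealSubfield L)) =
    realDiagonal L dV' hdV')

/-! ## §1 The packages of record ARE ★ `localSplittingCM`; §2 `hS`; §3 the line side `hΦ₁`; §4 HEAD -/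

section OfRecord

variable {n' : ℕ} (e₁ : Fin 3 × Fin 1 ≃ Fin n') (hdV0 : ∀ i, dV i ≠ 0) (hdV0' : ∀ i, dV' i ≠ 0) (ε : (↥(maximalRealSubfield L))ˣ)
  (θ : HeckeCharacter L) (hθ : IsSplittingChar L 1 θ)

/-- **the CM package of record at `diag dV ⊗ (ε)` IS ★ `localSplittingCM` at the pair Gram** (★ `congrW_undoubledSplittings_cmFinLocalFamily_s` read through the
`abbrev` ★ `chiLocalSplittingsCM`; Borel σ-algebra and Mathlib's `addHaar` inside ★ `localSplittingCM`). [cite: GelbartRogawski1991, §3.1 Prop. 3.1.1 p. 455 L1–3] -/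
theorem chiLocalSplittingsCM_s_eq_localSplittingCM :
    (chiLocalSplittingsCM L e₁ dV hdV hdV0 θ hθ ε).s v =
      localSplittingCM L n' (isSymm_gram (↥(maximalRealSubfield L)) e₁ (realDiagonal_isSymm L dV hdV) (isSymm_TW (↥(maximalRealSubfield L)) ε))
        (isUnit_det_gram (↥(maximalRealSubfield L)) e₁ (isUnit_det_realDiagonal L dV hdV hdV0) (isUnit_det_TW (↥(maximalRealSubfield L)) ε))
        (reindex_kronecker_eq_gram_map (↥(maximalRealSubfield L)) L e₁ (realDiagonal_map L dV hdV).symm (JW_eq (↥(maximalRealSubfield L)) L ε)) θ hθ v :=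
  congrW_undoubledSplittings_cmFinLocalFamily_s L e₁ dV hdV hdV0 (lineW L (TW (↥(maximalRealSubfield L)) ε)) (complexConj_lineW L (TW (↥(maximalRealSubfield L)) ε))
    (lineW_ne_zero L (TW (↥(maximalRealSubfield L)) ε) (isUnit_det_TW (↥(maximalRealSubfield L)) ε)) θ hθ
    (realDiagonal_lineW L (TW (↥(maximalRealSubfield L)) ε)) (diagonal_lineW L (TW (↥(maximalRealSubfield L)) ε) (JW_eq (↥(maximalRealSubfield L)) L ε))
    (isSymm_TW (↥(maximalRealSubfield L)) ε) (isUnit_det_TW (↥(maximalRealSubfield L)) ε) (JW_eq (↥(maximalRealSubfield L)) L ε) v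

/-- **the rank-one line package of record IS ★ `localSplittingCM`** at the pair Gram `gram e₀ (realDiagonal dL) (TW ε)` (the same ★ bridge at `N = 1`, read through the
`abbrev` ★ `lineSplittingsCM`). [cite: GelbartRogawski1991, §3.1 Prop. 3.1.1 p. 455 L1–3; §5.2 p. 467 L8–11] -/
theorem lineSplittingsCM_s_eq_localSplittingCM {n₀ : ℕ} (e₀ : Fin 1 × Fin 1 ≃ Fin n₀) (dL : Fin 1 → L)
    (hdL : ∀ i, IsCMField.complexConj L (dL i) = dL i) (hdL0 : ∀ i, dL i ≠ 0) :
    (lineSplittingsCM L e₀ dL hdL hdL0 θ hθ ε).s v =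
      localSplittingCM L n₀ (isSymm_gram (↥(maximalRealSubfield L)) e₀ (realDiagonal_isSymm L dL hdL) (isSymm_TW (↥(maximalRealSubfield L)) ε))
        (isUnit_det_gram (↥(maximalRealSubfield L)) e₀ (isUnit_det_realDiagonal L dL hdL hdL0) (isUnit_det_TW (↥(maximalRealSubfield L)) ε))
        (reindex_kronecker_eq_gram_map (↥(maximalRealSubfield L)) L e₀ (realDiagonal_map L dL hdL).symm (JW_eq (↥(maximalRealSubfield L)) L ε)) θ hθ v :=
  congrW_undoubledSplittings_cmFinLocalFamily_s L e₀ dL hdL hdL0 (lineW L (TW (↥(maximalRealSubfield L)) ε)) (complexConj_lineW L (TW (↥(maximalRealSubfield L)) ε))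
    (lineW_ne_zero L (TW (↥(maximalRealSubfield L)) ε) (isUnit_det_TW (↥(maximalRealSubfield L)) ε)) θ hθ
    (realDiagonal_lineW L (TW (↥(maximalRealSubfield L)) ε)) (diagonal_lineW L (TW (↥(maximalRealSubfield L)) ε) (JW_eq (↥(maximalRealSubfield L)) L ε))
    (isSymm_TW (↥(maximalRealSubfield L)) ε) (isUnit_det_TW (↥(maximalRealSubfield L)) ε) (JW_eq (↥(maximalRealSubfield L)) L ε) v

/-- `0 < m` for `Fin 1 × Fin 1 ≃ Fin m`. [folklore] -/
private theorem pos_of_equiv₁ {m : ℕ} (e : Fin 1 × Fin 1 ≃ Fin m) : 0 < m := Fin.pos (e (0, 0))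

/-- `0 < m` for `Fin 3 × Fin 1 ≃ Fin m`. [folklore] -/
private theorem pos_of_equiv {m : ℕ} (e : Fin 3 × Fin 1 ≃ Fin m) : 0 < m := Fin.pos (e (0, 0))

include hP in
set_option synthInstance.maxHeartbeats 400000 in
set_option maxHeartbeats 4000000 in
/-- **`hS` OF §2b DISCHARGED FOR THE PACKAGES OF RECORD** — the local Weil representations of ★ `chiLocalSplittingsCM` at `dV′` and at `dV` are `frameOp_{P ⊗ 1}`-intertwined
along `frameConj_{P ⊗ 1}`: (FN) (U) ★ `frameOp_toRep_localSplittingCMWith` (B-p08 (g24)) at the pair Gram `gram e₁ (realDiagonal dV) (TW ε)` (target Gram diagonal by ★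
`gram_diagonal_TW`), frame `reindexGL e₁ (kroneckerGL (P, 1))` (§1b (9)), Borel Haar data. [cite: MoeglinVignerasWaldspurger1987, Chap. 2 II Remarque (3)] [cite: Kudla1994, §3 Thm 3.1] -/
theorem frameOp_omegaLoc_chiLocalSplittingsCM
    (g' : localPi L (IsCMField.complexConj L) n' (Matrix.reindex e₁ e₁ (Matrix.diagonal dV' ⊗ₖ JW (↥(maximalRealSubfield L)) L ε)) v)
    (f : SchwartzBruhat (Fin n' → v.adicCompletion (↥(maximalRealSubfield L)))) :
    FrameTransport.frameOp (↥(maximalRealSubfield L)) v n' (UnitaryGroup.reindexGL e₁ (kroneckerGL (P, 1)))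
        (MpPsi.toRep (localSchrodinger (↥(maximalRealSubfield L)) n' (UnitaryDualPair.gram (↥(maximalRealSubfield L)) e₁ (realDiagonal L dV' hdV') (TW (↥(maximalRealSubfield L)) ε)) v)
          ((chiLocalSplittingsCM L e₁ dV' hdV' hdV0' θ hθ ε).s v g') f) =
      MpPsi.toRep (localSchrodinger (↥(maximalRealSubfield L)) n' (UnitaryDualPair.gram (↥(maximalRealSubfield L)) e₁ (realDiagonal L dV hdV) (TW (↥(maximalRealSubfield L)) ε)) v)
        ((chiLocalSplittingsCM L e₁ dV hdV hdV0 θ hθ ε).s v (FrameTransport.frameConj (↥(maximalRealSubfield L)) L (IsCMField.complexConj L) v n'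
          (reindex_kronecker_eq_gram_map (↥(maximalRealSubfield L)) L e₁ (realDiagonal_map L dV hdV).symm (JW_eq (↥(maximalRealSubfield L)) L ε))
          (reindex_kronecker_eq_gram_map (↥(maximalRealSubfield L)) L e₁ (realDiagonal_map L dV' hdV').symm (JW_eq (↥(maximalRealSubfield L)) L ε))
          (UnitaryGroup.reindexGL e₁ (kroneckerGL (P, 1))) (transpose_pairFrame_mul_gram_mul_pairFrame 3 e₁ P hP (TW (↥(maximalRealSubfield L)) ε)) g'))
        (FrameTransport.frameOp (↥(maximalRealSubfield L)) v n' (UnitaryGroup.reindexGL e₁ (kroneckerGL (P, 1))) f) := by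
  rw [chiLocalSplittingsCM_s_eq_localSplittingCM, chiLocalSplittingsCM_s_eq_localSplittingCM]
  letI : MeasurableSpace (v.adicCompletion ↥(maximalRealSubfield L)) := borel _
  haveI : BorelSpace (v.adicCompletion ↥(maximalRealSubfield L)) := ⟨rfl⟩
  have hU := frameOp_toRep_localSplittingCMWith L v MeasureTheory.Measure.addHaar n' (pos_of_equiv e₁)
    (fun i => (realDiagonal L dV' hdV') (e₁.symm i).1 (e₁.symm i).1 * ((ε : (↥(maximalRealSubfield L))ˣ) : ↥(maximalRealSubfield L)))
    (by unfold realDiagonal; rw [gram_diagonal_TW]; simp only [Matrix.diagonal_apply_eq])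
    (isSymm_gram (↥(maximalRealSubfield L)) e₁ (realDiagonal_isSymm L dV hdV) (isSymm_TW (↥(maximalRealSubfield L)) ε))
    (isUnit_det_gram (↥(maximalRealSubfield L)) e₁ (isUnit_det_realDiagonal L dV hdV hdV0) (isUnit_det_TW (↥(maximalRealSubfield L)) ε))
    (isSymm_gram (↥(maximalRealSubfield L)) e₁ (realDiagonal_isSymm L dV' hdV') (isSymm_TW (↥(maximalRealSubfield L)) ε))
    (isUnit_det_gram (↥(maximalRealSubfield L)) e₁ (isUnit_det_realDiagonal L dV' hdV' hdV0') (isUnit_det_TW (↥(maximalRealSubfield L)) ε))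
    (UnitaryGroup.reindexGL e₁ (kroneckerGL (P, 1))) (transpose_pairFrame_mul_gram_mul_pairFrame 3 e₁ P hP (TW (↥(maximalRealSubfield L)) ε))
    (reindex_kronecker_eq_gram_map (↥(maximalRealSubfield L)) L e₁ (realDiagonal_map L dV hdV).symm (JW_eq (↥(maximalRealSubfield L)) L ε))
    (reindex_kronecker_eq_gram_map (↥(maximalRealSubfield L)) L e₁ (realDiagonal_map L dV' hdV').symm (JW_eq (↥(maximalRealSubfield L)) L ε)) θ hθ g' f
  simp only [MonoidHom.comp_apply] at hU
  exact hU

/-! ### The line side: the 1×1 frame `det P` carries `kernelLineCM dV` to `kernelLineCM dV′` -/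

include hP in
/-- **the rank-one frame `det P`**: `(det P)ᵀ · (−d₀d₁d₂) · (det P) = −d₀′d₁′d₂′` — the Witt kernel lines of `diag dV`, `diag dV′ = Pᵀ diag(dV) P` differ by the rational
1×1 frame `det P` (determinants: `(det P)² · d₀d₁d₂ = d₀′d₁′d₂′`). [cite: Jacobowitz1962, Thm. 3.1] [cite: PlatonovRapinchuk1994, §2.3] -/
theorem transpose_detFrame_mul_realDiagonal_kernelLineCM_mul_detFrame :
    ((Units.map (Matrix.scalar (Fin 1)).toMonoidHom (Matrix.GeneralLinearGroup.det P) : GL (Fin 1) ↥(maximalRealSubfield L)) :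
        Matrix (Fin 1) (Fin 1) ↥(maximalRealSubfield L))ᵀ * realDiagonal L (kernelLineCM dV) (complexConj_kernelLineCM dV hdV) *
      ((Units.map (Matrix.scalar (Fin 1)).toMonoidHom (Matrix.GeneralLinearGroup.det P) : GL (Fin 1) ↥(maximalRealSubfield L)) :
        Matrix (Fin 1) (Fin 1) ↥(maximalRealSubfield L)) =
      realDiagonal L (kernelLineCM dV') (complexConj_kernelLineCM dV' hdV') := by
  -- determinants of the rank-3 frame identity, pushed to `L`
  have hdet := congrArg Matrix.det hP
  rw [Matrix.det_mul, Matrix.det_mul, Matrix.det_transpose] at hdet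
  unfold realDiagonal at hdet ⊢
  rw [Matrix.det_diagonal, Matrix.det_diagonal, Fin.prod_univ_three, Fin.prod_univ_three] at hdet
  have hdetL := congrArg (Subtype.val : ↥(maximalRealSubfield L) → L) hdet
  simp only [MulMemClass.coe_mul] at hdetL
  refine Matrix.ext fun i j => ?_
  rw [Subsingleton.elim i 0, Subsingleton.elim j 0]
  have hsc : ((Units.map (Matrix.scalar (Fin 1)).toMonoidHom (Matrix.GeneralLinearGroup.det P) : GL (Fin 1) ↥(maximalRealSubfield L)) :
        Matrix (Fin 1) (Fin 1) ↥(maximalRealSubfield L)) = Matrix.diagonal fun _ => (P : Matrix (Fin 3) (Fin 3) ↥(maximalRealSubfield L)).det := rfl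
  rw [hsc, Matrix.diagonal_transpose, Matrix.diagonal_mul_diagonal, Matrix.diagonal_mul_diagonal, Matrix.diagonal_apply_eq, Matrix.diagonal_apply_eq]
  refine Subtype.ext ?_
  simp only [MulMemClass.coe_mul, kernelLineCM]
  linear_combination (-1 : L) * hdetL



set_option synthInstance.maxHeartbeats 400000 in
set_option maxHeartbeats 4000000 in
include hP in
/-- **`hΦ₁` OF §2b DISCHARGED FOR THE LINE PACKAGE OF RECORD** — GR's `ω¹` at the Witt kernel lines `kernelLineCM dV′`, `kernelLineCM dV` (★ `lineWeilCM`) are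
`frameOp_{det P ⊗ 1}`-intertwined ON THE NOSE (same `u`): (FN) (U) at the rank-one pair Gram `gram e₀ (realDiagonal (kernelLineCM dV)) (TW ε)` with the frame
`reindexGL e₀ (kroneckerGL (det P, 1))`, and ★ `frameConj_localCenter` (the frame FIXES the `U((ε))`-member through which `lineWeilCM` reads `ω¹`).
[cite: GelbartRogawski1991, §5.2 p. 467 L8–11; §3.2 (3.2.1) p. 457] [cite: MoeglinVignerasWaldspurger1987, Chap. 2 II Remarque (3)] -/
theorem frameOp_lineWeilCM {n₀ : ℕ} (e₀ : Fin 1 × Fin 1 ≃ Fin n₀) (μ : Literature.NumberTheory.Automorphic.IdeleClassGroup L →ₜ* Circle) (hμ : IsConjugateSymplectic L μ)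
    (u : localPi L (IsCMField.complexConj L) 1 (JW (↥(maximalRealSubfield L)) L ε) v) (m : SchwartzBruhat (Fin n₀ → v.adicCompletion ↥(maximalRealSubfield L))) :
    FrameTransport.frameOp (↥(maximalRealSubfield L)) v n₀ (UnitaryGroup.reindexGL e₀ (kroneckerGL (Units.map (Matrix.scalar (Fin 1)).toMonoidHom (Matrix.GeneralLinearGroup.det P), 1)))
        (lineWeilCM L e₀ (kernelLineCM dV') (complexConj_kernelLineCM dV' hdV') (kernelLineCM_ne_zero dV' hdV0') μ hμ ε v u m) =
      lineWeilCM L e₀ (kernelLineCM dV) (complexConj_kernelLineCM dV hdV) (kernelLineCM_ne_zero dV hdV0) μ hμ ε v u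
        (FrameTransport.frameOp (↥(maximalRealSubfield L)) v n₀ (UnitaryGroup.reindexGL e₀ (kroneckerGL (Units.map (Matrix.scalar (Fin 1)).toMonoidHom (Matrix.GeneralLinearGroup.det P), 1))) m) := by
  dsimp only [lineWeilCM, FinLocalSplittings.omegaLoc]
  rw [MonoidHom.comp_apply, MonoidHom.comp_apply, MonoidHom.comp_apply, MonoidHom.comp_apply]
  rw [lineSplittingsCM_s_eq_localSplittingCM, lineSplittingsCM_s_eq_localSplittingCM]
  letI : MeasurableSpace (v.adicCompletion ↥(maximalRealSubfield L)) := borel _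
  haveI : BorelSpace (v.adicCompletion ↥(maximalRealSubfield L)) := ⟨rfl⟩
  have hU := frameOp_toRep_localSplittingCMWith L v MeasureTheory.Measure.addHaar n₀ (pos_of_equiv₁ e₀)
    (fun i => (realDiagonal L (kernelLineCM dV') (complexConj_kernelLineCM dV' hdV')) (e₀.symm i).1 (e₀.symm i).1 * ((ε : (↥(maximalRealSubfield L))ˣ) : ↥(maximalRealSubfield L)))
    (by unfold realDiagonal; rw [gram_diagonal_TW]; simp only [Matrix.diagonal_apply_eq])
    (isSymm_gram (↥(maximalRealSubfield L)) e₀ (realDiagonal_isSymm L (kernelLineCM dV) (complexConj_kernelLineCM dV hdV)) (isSymm_TW (↥(maximalRealSubfield L)) ε))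
    (isUnit_det_gram (↥(maximalRealSubfield L)) e₀ (isUnit_det_realDiagonal L (kernelLineCM dV) (complexConj_kernelLineCM dV hdV) (kernelLineCM_ne_zero dV hdV0))
      (isUnit_det_TW (↥(maximalRealSubfield L)) ε))
    (isSymm_gram (↥(maximalRealSubfield L)) e₀ (realDiagonal_isSymm L (kernelLineCM dV') (complexConj_kernelLineCM dV' hdV')) (isSymm_TW (↥(maximalRealSubfield L)) ε))
    (isUnit_det_gram (↥(maximalRealSubfield L)) e₀ (isUnit_det_realDiagonal L (kernelLineCM dV') (complexConj_kernelLineCM dV' hdV') (kernelLineCM_ne_zero dV' hdV0'))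
      (isUnit_det_TW (↥(maximalRealSubfield L)) ε))
    (UnitaryGroup.reindexGL e₀ (kroneckerGL (Units.map (Matrix.scalar (Fin 1)).toMonoidHom (Matrix.GeneralLinearGroup.det P), 1)))
    (transpose_pairFrame_mul_gram_mul_pairFrame 1 e₀ (Units.map (Matrix.scalar (Fin 1)).toMonoidHom (Matrix.GeneralLinearGroup.det P))
      (transpose_detFrame_mul_realDiagonal_kernelLineCM_mul_detFrame L dV dV' hdV hdV' P hP) (TW (↥(maximalRealSubfield L)) ε))
    (reindex_kronecker_eq_gram_map (↥(maximalRealSubfield L)) L e₀ (realDiagonal_map L (kernelLineCM dV) (complexConj_kernelLineCM dV hdV)).symm (JW_eq (↥(maximalRealSubfield L)) L ε))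
    (reindex_kronecker_eq_gram_map (↥(maximalRealSubfield L)) L e₀ (realDiagonal_map L (kernelLineCM dV') (complexConj_kernelLineCM dV' hdV')).symm (JW_eq (↥(maximalRealSubfield L)) L ε))
    (toHeckeCharacter L μ) ((isOscillatorChar_toHeckeCharacter_iff μ).mpr hμ)
    (localCenter L (IsCMField.complexConj L) n₀ (Matrix.reindex e₀ e₀ (Matrix.diagonal (kernelLineCM dV') ⊗ₖ JW (↥(maximalRealSubfield L)) L ε))
      (JW (↥(maximalRealSubfield L)) L ε) (JW_apply_ne_zero (↥(maximalRealSubfield L)) L ε) v u) m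
  rw [MonoidHom.comp_apply, MonoidHom.comp_apply, FrameTransport.frameConj_localCenter] at hU
  exact hU

include hP in
set_option synthInstance.maxHeartbeats 400000 in
set_option maxHeartbeats 4000000 in
/-- **THE (E4) DICTIONARY OF `X_v(μ, ε, χ_f)` TRANSPORTS ALONG A RATIONAL FRAME — PACKAGES OF RECORD, NO SIDE HYPOTHESIS** (§2b with `hS` ∕ `hΦ₁` discharged BY NAME:
`frameOp_omegaLoc_chiLocalSplittingsCM`, `frameOp_lineWeilCM`): for `Pᵀ diag(dV) P = diag(dV′)`, `P·T′ = T`, every (E4)-shaped dictionary `(π, σ, Tr, η)` for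
`(dV, T)` at the package ★ `chiLocalSplittingsCM … dV … ε` and the line model ★ `lineWeilCM … (kernelLineCM dV) … ε v` yields one for `(dV′, T′)` with the SAME `σ` and the
SAME `η` — `η_{dV,T} = η_{dV′,T′}` as SETS of admissible characters.  Consumer: F0P2-p01 (g8)'s (E5)∕(N-iii) assembler (the (E4) construction re-read at the block-model frame
`diag(t) ⊕ᶠ T_H` of ★ `exists_rational_hyperbolic_frame`). [cite: GelbartRogawski1991, §3.2 (3.2.1)–(3.2.2) p. 457] [cite: MoeglinVignerasWaldspurger1987, Chap. 2 II Remarque (3)]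
[cite: Kudla1994, §3 Thm 3.1] [cite: PlatonovRapinchuk1994, §2.3] -/
theorem dictionary_frameTransport_ofRecord {n₀ : ℕ} (e₀ : Fin 1 × Fin 1 ≃ Fin n₀)
    (μ : Literature.NumberTheory.Automorphic.IdeleClassGroup L →ₜ* Circle) (hμ : IsConjugateSymplectic L μ)
    (T : GL (Fin 3) (LocalRing L v)) {a : LocalRing L v} (ha : IsUnit a)
    (h : formCongr (conjLocal L (IsCMField.complexConj L) v) T ((Matrix.diagonal dV).map (algebraMap L (LocalRing L v))) =
      a • (Matrix.of fun i j : Fin 3 => if i.val + j.val + 1 = 3 then (1 : L) else 0).map (algebraMap L (LocalRing L v)))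
    (T' : GL (Fin 3) (LocalRing L v)) (hT' : FrameTransport.framePloc (↥(maximalRealSubfield L)) L v 3 P * T' = T) {a' : LocalRing L v} (ha' : IsUnit a')
    (h' : formCongr (conjLocal L (IsCMField.complexConj L) v) T' ((Matrix.diagonal dV').map (algebraMap L (LocalRing L v))) =
      a' • (Matrix.of fun i j : Fin 3 => if i.val + j.val + 1 = 3 then (1 : L) else 0).map (algebraMap L (LocalRing L v)))
    (N : Subgroup (Gqs L v))
    {M : Type} [AddCommGroup M] [Module ℂ M] (η : localPi L (IsCMField.complexConj L) 1 (JW (↥(maximalRealSubfield L)) L ε) v →* ℂˣ)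
    (hdict : ∃ (π : SchwartzBruhat (Fin n' → v.adicCompletion (↥(maximalRealSubfield L))) →ₗ[ℂ] M) (σ : Representation ℂ (localPi L (IsCMField.complexConj L) 1 (JW (↥(maximalRealSubfield L)) L ε) v) M)
        (Tr : M ≃ₗ[ℂ] SchwartzBruhat (Fin n₀ → v.adicCompletion (↥(maximalRealSubfield L)))),
      Function.Surjective π ∧
      LinearMap.ker π = Representation.Coinvariants.ker
        ((((MpPsi.toRep (localSchrodinger (↥(maximalRealSubfield L)) n' (UnitaryDualPair.gram (↥(maximalRealSubfield L)) e₁ (realDiagonal L dV hdV) (TW (↥(maximalRealSubfield L)) ε)) v)).comp ((chiLocalSplittingsCM L e₁ dV hdV hdV0 (toHeckeCharacter L μ) ((isOscillatorChar_toHeckeCharacter_iff μ).mpr hμ) ε).s v)).comp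
          ((localLineInl L (IsCMField.complexConj L) 3 e₁ (Matrix.diagonal dV) (JW (↥(maximalRealSubfield L)) L ε) v).comp
            ((localPiEquiv L (IsCMField.complexConj L) 3 (Matrix.diagonal dV) v).symm.toMonoidHom.comp (cmDatumLocalCongr L v T ha h).toMonoidHom))).comp N.subtype) ∧
      (∀ (u : localPi L (IsCMField.complexConj L) 1 (JW (↥(maximalRealSubfield L)) L ε) v) (f : SchwartzBruhat (Fin n' → v.adicCompletion (↥(maximalRealSubfield L)))),
        π (MpPsi.toRep (localSchrodinger (↥(maximalRealSubfield L)) n' (UnitaryDualPair.gram (↥(maximalRealSubfield L)) e₁ (realDiagonal L dV hdV) (TW (↥(maximalRealSubfield L)) ε)) v)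
          ((chiLocalSplittingsCM L e₁ dV hdV hdV0 (toHeckeCharacter L μ) ((isOscillatorChar_toHeckeCharacter_iff μ).mpr hμ) ε).s v (localCenter L (IsCMField.complexConj L) n' (Matrix.reindex e₁ e₁ (Matrix.diagonal dV ⊗ₖ JW (↥(maximalRealSubfield L)) L ε)) (JW (↥(maximalRealSubfield L)) L ε) (JW_apply_ne_zero (↥(maximalRealSubfield L)) L ε) v u)) f) = σ u (π f)) ∧
      ∀ (u : localPi L (IsCMField.complexConj L) 1 (JW (↥(maximalRealSubfield L)) L ε) v) (m : M),
        lineWeilCM L e₀ (kernelLineCM dV) (complexConj_kernelLineCM dV hdV) (kernelLineCM_ne_zero dV hdV0) μ hμ ε v u (Tr m) = ((η u : ℂˣ) : ℂ) • Tr (σ u m)) :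
    ∃ (π' : SchwartzBruhat (Fin n' → v.adicCompletion (↥(maximalRealSubfield L))) →ₗ[ℂ] M) (σ : Representation ℂ (localPi L (IsCMField.complexConj L) 1 (JW (↥(maximalRealSubfield L)) L ε) v) M)
        (Tr' : M ≃ₗ[ℂ] SchwartzBruhat (Fin n₀ → v.adicCompletion (↥(maximalRealSubfield L)))),
      Function.Surjective π' ∧
      LinearMap.ker π' = Representation.Coinvariants.ker
        ((((MpPsi.toRep (localSchrodinger (↥(maximalRealSubfield L)) n' (UnitaryDualPair.gram (↥(maximalRealSubfield L)) e₁ (realDiagonal L dV' hdV') (TW (↥(maximalRealSubfield L)) ε)) v)).comp ((chiLocalSplittingsCM L e₁ dV' hdV' hdV0' (toHeckeCharacter L μ) ((isOscillatorChar_toHeckeCharacter_iff μ).mpr hμ) ε).s v)).comp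
          ((localLineInl L (IsCMField.complexConj L) 3 e₁ (Matrix.diagonal dV') (JW (↥(maximalRealSubfield L)) L ε) v).comp
            ((localPiEquiv L (IsCMField.complexConj L) 3 (Matrix.diagonal dV') v).symm.toMonoidHom.comp (cmDatumLocalCongr L v T' ha' h').toMonoidHom))).comp N.subtype) ∧
      (∀ (u : localPi L (IsCMField.complexConj L) 1 (JW (↥(maximalRealSubfield L)) L ε) v) (f : SchwartzBruhat (Fin n' → v.adicCompletion (↥(maximalRealSubfield L)))),
        π' (MpPsi.toRep (localSchrodinger (↥(maximalRealSubfield L)) n' (UnitaryDualPair.gram (↥(maximalRealSubfield L)) e₁ (realDiagonal L dV' hdV') (TW (↥(maximalRealSubfield L)) ε)) v)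
          ((chiLocalSplittingsCM L e₁ dV' hdV' hdV0' (toHeckeCharacter L μ) ((isOscillatorChar_toHeckeCharacter_iff μ).mpr hμ) ε).s v (localCenter L (IsCMField.complexConj L) n' (Matrix.reindex e₁ e₁ (Matrix.diagonal dV' ⊗ₖ JW (↥(maximalRealSubfield L)) L ε)) (JW (↥(maximalRealSubfield L)) L ε) (JW_apply_ne_zero (↥(maximalRealSubfield L)) L ε) v u)) f) = σ u (π' f)) ∧
      ∀ (u : localPi L (IsCMField.complexConj L) 1 (JW (↥(maximalRealSubfield L)) L ε) v) (m : M),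
        lineWeilCM L e₀ (kernelLineCM dV') (complexConj_kernelLineCM dV' hdV') (kernelLineCM_ne_zero dV' hdV0') μ hμ ε v u (Tr' m) = ((η u : ℂˣ) : ℂ) • Tr' (σ u m) :=
  dictionary_frameTransport L v dV dV' hdV hdV' P hP e₁ hdV0 hdV0' ε (chiLocalSplittingsCM L e₁ dV hdV hdV0 (toHeckeCharacter L μ) ((isOscillatorChar_toHeckeCharacter_iff μ).mpr hμ) ε) (chiLocalSplittingsCM L e₁ dV' hdV' hdV0' (toHeckeCharacter L μ) ((isOscillatorChar_toHeckeCharacter_iff μ).mpr hμ) ε)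
    (frameOp_omegaLoc_chiLocalSplittingsCM L v dV dV' hdV hdV' P hP e₁ hdV0 hdV0' ε (toHeckeCharacter L μ) ((isOscillatorChar_toHeckeCharacter_iff μ).mpr hμ))
    T ha h T' hT' ha' h' N e₀ μ hμ
    (FrameTransport.frameOp (↥(maximalRealSubfield L)) v n₀ (UnitaryGroup.reindexGL e₀ (kroneckerGL (Units.map (Matrix.scalar (Fin 1)).toMonoidHom (Matrix.GeneralLinearGroup.det P), 1))))
    (frameOp_lineWeilCM L v dV dV' hdV hdV' P hP hdV0 hdV0' ε e₀ μ hμ) η hdict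

end OfRecord

end Summit.HodgeConjecture.HodgeConjecture.Cruxes.H413.F0P2oLineWeilDictionaryFrameTransportOfRecord

end
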